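import Literature.NumberTheory.LFunctions.BurnolSonineZeros
import Literature.Analysis.Fourier.L2FourierReflection
import Literature.Analysis.Fourier.L2FourierMultiplication
import HarnessLib

/-!
# The cosine transform on even `L²` functions and the Sonine spaces `K_a`

LINE 1 — LABEL: RH-FREE (`L²` Fourier analysis of even functions; no hypothesis and no conclusion
about zeros of `ζ`). bears_on: B-C/B-P (LADDER-RH COLUMN 6, de Branges framework).
WHAT THIS IS NOT: not a route, not an RH criterion; nothing here bears on the truth of RH.

Burnol [Burnol2004, §5–§6] works with the cosine transform `𝓕₊` = the Fourier transform `𝓕`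
restricted to even functions (an involution), the Sonine spaces `K_λ` [Burnol2004, Def. 6.1,
TeX l.2224–2228: "square-integrable (even) functions `f(t)` vanishing in `(0,λ)`, and such that
`𝓕₊(f)(t)` also vanishes in `(0,λ)`"] (tree: `Literature.NumberTheory.LFunctions.sonineK`), and the
"euclidean bilinear form `[B,C] = ∫₀^∞ B(t)C(t)dt`" [Burnol2004, TeX l.1958–1959], for which
`[𝓕₊(Z), f] = [Z, 𝓕₊(f)]` (first step of the proof of [Burnol2004, Prop. 6.7], TeX l.2377). This
theorem-only module proves, for Mathlib's `L²` Fourier transform on `Lp ℂ 2 (volume : Measure ℝ)`: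

* `compNeg_eq_self_of_mem_evenL2`, `fourier_mem_evenL2`, `fourier_fourier_eq_self_of_mem_evenL2`
  (`𝓕` preserves evenness and `𝓕𝓕 f = f` for even `f` — `𝓕₊` is an involution);
* `fourier_mem_sonineK`, `fourier_mem_sonineL` (**`K_a` and `L_a` are stable under `𝓕₊`**, immediate
  from Def. 6.1 / [Burnol2004b, §2] and the involution);
* `integral_eq_two_mul_setIntegral_Ioi_of_ae_even`, `setIntegral_Ioi_mul_fourier_eq_of_mem_evenL2`
  (**`[f, 𝓕₊ Z] = [𝓕₊ f, Z]`** for even `L²` functions, from the `L²` multiplication formula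
  `Literature.Analysis.Fourier.integral_mul_fourier_eq`);
* `smul_mem_evenL2`, `smul_mem_sonineK`, `add_mem_evenL2`, `add_mem_sonineK` (linearity), and `isSonineZ_fourier_of_functionalEquation`:
  [Burnol2004, Prop. 6.7] `𝓕₊ Z^a_{w,k} = (−1)^k Z^a_{1−w,k}` (for the evaluators `IsSonineZ` of
  `BurnolSonineZeros.lean`) REDUCED, by Burnol's own three-line proof, to the functional equation
  `𝒢_{𝓕₊f}(s) = 𝒢_f(1−s)` of the entire completed Mellin transform on `K_a` (explicit hypothesis;
  de Branges' theory, the tree's `Burnol2004b_thm2_1`).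

## References
* [Burnol2004] J.-F. Burnol, *On Fourier and Zeta(s)*, Forum Math. 16 (2004) 789–840
  = arXiv:math/0112254: Def. 6.1 (TeX l.2224), TeX l.1958–1959, proof of Prop. 6.7 (TeX l.2376–2379).
* [Grafakos2014] L. Grafakos, *Classical Fourier Analysis*, 3rd ed.: Thm. 2.2.14 (1),(2), PDF p. 128.
-/

noncomputable section

open MeasureTheory FourierTransform Set Filter
open Literature.Analysis.Fourier

namespace Literature.NumberTheory.LFunctions

section SonineFourier

/-- An even `L²` class is fixed by the reflection `R u = u(−·)`. [cite: Burnol2004, Def. 6.1 (TeX l.2224), "(even) functions"] -/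
theorem compNeg_eq_self_of_mem_evenL2 {f : Lp ℂ 2 (volume : Measure ℝ)} (hf : f ∈ evenL2) :
    Lp.compMeasurePreserving (fun x : ℝ => -x) (Measure.measurePreserving_neg (volume : Measure ℝ))
      f = f := by
  apply Lp.ext
  filter_upwards [coeFn_compNeg (F := ℂ) f, hf] with x h1 h2
  rw [h1, h2]

/-- **`𝓕` preserves evenness**: the Fourier transform of an even `L²` function is even (so `𝓕`
restricts to the cosine transform `𝓕₊` on even functions). [cite: Burnol2004, Def. 6.1 (TeX l.2224); Grafakos2014, Prop. 2.2.11 (4), PDF p. 126] -/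
theorem fourier_mem_evenL2 {f : Lp ℂ 2 (volume : Measure ℝ)} (hf : f ∈ evenL2) :
    (𝓕 f : Lp ℂ 2 (volume : Measure ℝ)) ∈ evenL2 := by
  have h := fourier_compNeg (F := ℂ) f
  rw [compNeg_eq_self_of_mem_evenL2 hf] at h
  -- `𝓕 f = R (𝓕 f)`
  have hae := coeFn_compNeg (F := ℂ) (𝓕 f : Lp ℂ 2 (volume : Measure ℝ))
  rw [← h] at hae
  simp only [evenL2, Set.mem_setOf_eq]
  filter_upwards [hae] with x hx
  exact hx.symm

/-- **`𝓕₊` is an involution**: `𝓕 (𝓕 f) = f` for even `f ∈ L²(ℝ)` (`𝓕𝓕 = R` and `R f = f`).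
[cite: Grafakos2014, Thm. 2.2.14 (2), PDF p. 128; Burnol2004, §5 (TeX l.1977, `𝓕₊` of square `1`)] -/
theorem fourier_fourier_eq_self_of_mem_evenL2 {f : Lp ℂ 2 (volume : Measure ℝ)} (hf : f ∈ evenL2) :
    (𝓕 (𝓕 f : Lp ℂ 2 (volume : Measure ℝ)) : Lp ℂ 2 (volume : Measure ℝ)) = f := by
  rw [fourier_fourier_eq_compNeg, compNeg_eq_self_of_mem_evenL2 hf]

/-- **The Sonine space `K_a` is stable under the cosine transform**: `f ∈ K_a → 𝓕 f ∈ K_a`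
(Def. 6.1 is symmetric in `f` and `𝓕₊ f` because `𝓕₊𝓕₊ = 1`). [cite: Burnol2004, Def. 6.1 (TeX l.2224–2228)] -/
theorem fourier_mem_sonineK {a : ℝ} {f : Lp ℂ 2 (volume : Measure ℝ)} (hf : f ∈ sonineK a) :
    (𝓕 f : Lp ℂ 2 (volume : Measure ℝ)) ∈ sonineK a := by
  obtain ⟨he, h0, h1⟩ := hf
  refine ⟨fourier_mem_evenL2 he, h1, ?_⟩
  rw [fourier_fourier_eq_self_of_mem_evenL2 he]
  exact h0

/-- **The extended Sonine space `L_a` is stable under the cosine transform**: `f ∈ L_a → 𝓕 f ∈ L_a`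
(its definition — `f` constant on `(0,a)` and `𝓕₊f` constant on `(0,a)` — is symmetric under the
involution `𝓕₊`). [cite: Burnol2004b, §2 (arXiv:math/0203120v7 p. 5, TeX l.423–428)] -/
theorem fourier_mem_sonineL {a : ℝ} {f : Lp ℂ 2 (volume : Measure ℝ)} (hf : f ∈ sonineL a) :
    (𝓕 f : Lp ℂ 2 (volume : Measure ℝ)) ∈ sonineL a := by
  obtain ⟨he, h0, h1⟩ := hf
  refine ⟨fourier_mem_evenL2 he, h1, ?_⟩
  rw [fourier_fourier_eq_self_of_mem_evenL2 he]
  exact h0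

/-- `∫_ℝ h = 2 ∫₀^∞ h` for an integrable, almost-everywhere even `h`. [cite: Burnol2004, TeX l.1958–1959 (the bilinear form on `(0,∞)` for even functions)] -/
theorem integral_eq_two_mul_setIntegral_Ioi_of_ae_even {h : ℝ → ℂ} (hi : Integrable h)
    (he : ∀ᵐ x : ℝ, h (-x) = h x) :
    ∫ x, h x = 2 * ∫ x in Ioi (0 : ℝ), h x := by
  rw [← intervalIntegral.integral_Iic_add_Ioi (b := 0) hi.integrableOn hi.integrableOn]
  have : ∫ v in Iic (0 : ℝ), h v = ∫ v in Ioi (0 : ℝ), h v := by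
    calc ∫ v in Iic (0 : ℝ), h v = ∫ v in Iic (0 : ℝ), h (-v) :=
          integral_congr_ae (ae_restrict_of_ae (by filter_upwards [he] with v hv; exact hv.symm))
      _ = ∫ v in Ioi (-0 : ℝ), h v := integral_comp_neg_Iic 0 h
      _ = ∫ v in Ioi (0 : ℝ), h v := by rw [neg_zero]
  rw [this, two_mul]

/-- **Self-adjointness of the cosine transform for the euclidean bilinear form**:
`[f, 𝓕₊ Z] = [𝓕₊ f, Z]`, i.e. `∫₀^∞ f·𝓕Z = ∫₀^∞ 𝓕f·Z` for even `f, Z ∈ L²(ℝ)` (first step of the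
proof of Prop. 6.7). [cite: Burnol2004, proof of Prop. 6.7 (TeX l.2376–2379); Grafakos2014, Thm. 2.2.14 (1), PDF p. 128] -/
theorem setIntegral_Ioi_mul_fourier_eq_of_mem_evenL2 {f Z : Lp ℂ 2 (volume : Measure ℝ)}
    (hf : f ∈ evenL2) (hZ : Z ∈ evenL2) :
    ∫ t in Ioi (0 : ℝ), f t * (𝓕 Z : Lp ℂ 2 (volume : Measure ℝ)) t =
      ∫ t in Ioi (0 : ℝ), (𝓕 f : Lp ℂ 2 (volume : Measure ℝ)) t * Z t := by
  have hFZ := fourier_mem_evenL2 hZ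
  have hFf := fourier_mem_evenL2 hf
  have i1 : Integrable (fun t : ℝ ↦ f t * (𝓕 Z : Lp ℂ 2 (volume : Measure ℝ)) t) :=
    (Lp.memLp f).integrable_mul (Lp.memLp (𝓕 Z : Lp ℂ 2 (volume : Measure ℝ)))
  have i2 : Integrable (fun t : ℝ ↦ (𝓕 f : Lp ℂ 2 (volume : Measure ℝ)) t * Z t) :=
    (Lp.memLp (𝓕 f : Lp ℂ 2 (volume : Measure ℝ))).integrable_mul (Lp.memLp Z)
  have e1 : ∀ᵐ x : ℝ, f (-x) * (𝓕 Z : Lp ℂ 2 (volume : Measure ℝ)) (-x) =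
      f x * (𝓕 Z : Lp ℂ 2 (volume : Measure ℝ)) x := by
    filter_upwards [hf, hFZ] with x h1 h2
    rw [h1, h2]
  have e2 : ∀ᵐ x : ℝ, (𝓕 f : Lp ℂ 2 (volume : Measure ℝ)) (-x) * Z (-x) =
      (𝓕 f : Lp ℂ 2 (volume : Measure ℝ)) x * Z x := by
    filter_upwards [hFf, hZ] with x h1 h2
    rw [h1, h2]
  have h := integral_mul_fourier_eq (V := ℝ) f Z
  rw [integral_eq_two_mul_setIntegral_Ioi_of_ae_even i1 e1,
    integral_eq_two_mul_setIntegral_Ioi_of_ae_even i2 e2] at h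
  exact mul_left_cancel₀ two_ne_zero h

/-- Even `L²` classes are stable under scalars. [cite: Burnol2004, Def. 6.1 (TeX l.2224), "Hilbert space"] -/
theorem smul_mem_evenL2 (c : ℂ) {f : Lp ℂ 2 (volume : Measure ℝ)} (hf : f ∈ evenL2) :
    c • f ∈ evenL2 := by
  have hneg : Measure.QuasiMeasurePreserving (fun x : ℝ => -x) volume volume :=
    (Measure.measurePreserving_neg (volume : Measure ℝ)).quasiMeasurePreserving
  have h1 := Lp.coeFn_smul c f
  have h2 := hneg.ae h1
  simp only [evenL2, Set.mem_setOf_eq]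
  filter_upwards [h1, h2, hf] with x hx hx' hfx
  rw [hx', hx, Pi.smul_apply, Pi.smul_apply, hfx]

/-- **`K_a` is a linear subspace, scalar part**: `f ∈ K_a → c•f ∈ K_a`. [cite: Burnol2004, Def. 6.1 (TeX l.2224–2228), "the Hilbert space of …"] -/
theorem smul_mem_sonineK {a : ℝ} (c : ℂ) {f : Lp ℂ 2 (volume : Measure ℝ)} (hf : f ∈ sonineK a) :
    c • f ∈ sonineK a := by
  obtain ⟨he, h0, h1⟩ := hf
  refine ⟨smul_mem_evenL2 c he, ?_, ?_⟩
  · filter_upwards [Lp.coeFn_smul c f, h0] with x hx h hxa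
    rw [hx, Pi.smul_apply, h hxa, smul_zero]
  · rw [fourier_smul]
    filter_upwards [Lp.coeFn_smul c (𝓕 f : Lp ℂ 2 (volume : Measure ℝ)), h1] with x hx h hxa
    rw [hx, Pi.smul_apply, h hxa, smul_zero]

/-- Even `L²` classes are stable under addition. [cite: Burnol2004, Def. 6.1 (TeX l.2224), "Hilbert space"] -/
theorem add_mem_evenL2 {f g : Lp ℂ 2 (volume : Measure ℝ)} (hf : f ∈ evenL2) (hg : g ∈ evenL2) :
    f + g ∈ evenL2 := by
  have hneg : Measure.QuasiMeasurePreserving (fun x : ℝ => -x) volume volume :=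
    (Measure.measurePreserving_neg (volume : Measure ℝ)).quasiMeasurePreserving
  have h1 := Lp.coeFn_add f g
  have h2 := hneg.ae h1
  simp only [evenL2, Set.mem_setOf_eq]
  filter_upwards [h1, h2, hf, hg] with x hx hx' hfx hgx
  rw [hx', hx, Pi.add_apply, Pi.add_apply, hfx, hgx]

/-- **`K_a` is a linear subspace, additive part**: `f, g ∈ K_a → f + g ∈ K_a`. [cite: Burnol2004, Def. 6.1 (TeX l.2224–2228), "the Hilbert space of …"] -/
theorem add_mem_sonineK {a : ℝ} {f g : Lp ℂ 2 (volume : Measure ℝ)} (hf : f ∈ sonineK a)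
    (hg : g ∈ sonineK a) : f + g ∈ sonineK a := by
  obtain ⟨hfe, hf0, hf1⟩ := hf
  obtain ⟨hge, hg0, hg1⟩ := hg
  refine ⟨add_mem_evenL2 hfe hge, ?_, ?_⟩
  · filter_upwards [Lp.coeFn_add f g, hf0, hg0] with x hx h h' hxa
    rw [hx, Pi.add_apply, h hxa, h' hxa, add_zero]
  · rw [FourierTransform.fourier_add]
    filter_upwards [Lp.coeFn_add (𝓕 f : Lp ℂ 2 (volume : Measure ℝ)) (𝓕 g : Lp ℂ 2 (volume : Measure ℝ)),
      hf1, hg1] with x hx h h' hxa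
    rw [hx, Pi.add_apply, h hxa, h' hxa, add_zero]

/-- **Prop. 6.7 reduced to the Mellin functional equation.** Burnol's proof of
`𝓕₊(Z^λ_{w,k}) = (−1)^k Z^λ_{1−w,k}` [Burnol2004, Prop. 6.7] reads: "`[𝓕₊(Z^λ_{w,k}), f] =
[Z^λ_{w,k}, 𝓕₊(f)] = M(𝓕₊(f))^{(k)}(w) = (−1)^k M(f)^{(k)}(1−w)` from `M(𝓕₊(f))(w) = M(f)(1−w)`"
(TeX l.2376–2379). This theorem IS that argument, with the functional equation of the entire
completed Mellin transform on `K_a` (`completedMellinEntire`, de Branges' theory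
[Burnol2004b, Thm. 2.1]; the tree's facts `Burnol2004b_thm2_1`/`Burnol2004b_prop2_2`) taken as the
explicit hypothesis `hFE`; the self-adjointness step is `setIntegral_Ioi_mul_fourier_eq_of_mem_evenL2`
and the `𝓕₊`-stability of `K_a` is `fourier_mem_sonineK`. (The tree's unconditional statement is the
named fact `Burnol2004_prop_6_7` of `BurnolFourierZetaSonine.lean`.)
[cite: Burnol2004, Prop. 6.7 and its proof (TeX l.2372–2379)] -/
theorem isSonineZ_fourier_of_functionalEquation {a : ℝ}
    (hFE : ∀ f ∈ sonineK a,
      completedMellinEntire (((𝓕 f : Lp ℂ 2 (volume : Measure ℝ)) : Lp ℂ 2 (volume : Measure ℝ)) :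
          ℝ → ℂ) =
        fun s ↦ completedMellinEntire (f : ℝ → ℂ) (1 - s))
    {w : ℂ} {k : ℕ} {Z : Lp ℂ 2 (volume : Measure ℝ)} (hZ : IsSonineZ a w k Z) :
    IsSonineZ a (1 - w) k (((-1 : ℂ) ^ k) • (𝓕 Z : Lp ℂ 2 (volume : Measure ℝ))) := by
  obtain ⟨hZK, hZev⟩ := hZ
  refine ⟨smul_mem_sonineK _ (fourier_mem_sonineK hZK), fun f hf ↦ ?_⟩
  have hsmul := Lp.coeFn_smul ((-1 : ℂ) ^ k) (𝓕 Z : Lp ℂ 2 (volume : Measure ℝ))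
  calc ∫ t in Ioi (0 : ℝ), f t * (((-1 : ℂ) ^ k) • (𝓕 Z : Lp ℂ 2 (volume : Measure ℝ))) t
      = ∫ t in Ioi (0 : ℝ), (-1 : ℂ) ^ k * (f t * (𝓕 Z : Lp ℂ 2 (volume : Measure ℝ)) t) := by
        refine integral_congr_ae (ae_restrict_of_ae ?_)
        filter_upwards [hsmul] with t ht
        rw [ht, Pi.smul_apply, smul_eq_mul]
        ring
    _ = (-1 : ℂ) ^ k * ∫ t in Ioi (0 : ℝ), (𝓕 f : Lp ℂ 2 (volume : Measure ℝ)) t * Z t := by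
        rw [integral_const_mul, setIntegral_Ioi_mul_fourier_eq_of_mem_evenL2 hf.1 hZK.1]
    _ = (-1 : ℂ) ^ k * iteratedDeriv k
          (completedMellinEntire (((𝓕 f : Lp ℂ 2 (volume : Measure ℝ)) :
            Lp ℂ 2 (volume : Measure ℝ)) : ℝ → ℂ)) w := by
        rw [hZev _ (fourier_mem_sonineK hf)]
    _ = iteratedDeriv k (completedMellinEntire (f : ℝ → ℂ)) (1 - w) := by
        rw [hFE f hf, iteratedDeriv_comp_const_sub]
        dsimp only
        rw [smul_eq_mul, ← mul_assoc, ← mul_pow]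
        norm_num

end SonineFourier

end Literature.NumberTheory.LFunctions
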